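import Mathlib
import Literature.Barriers.MatrixMultiplication.NormalizerBarrier
import Summits.MatrixMultiplication.MatrixMultiplication.Theorems.LevelOneGL2Designs.Negative.LevelSpace

/-!
# The double-coset sieve: a subgroup identity design forces a bi-invariant separator of `H₁H₃` inside `H₁H₂H₃`
(negative-side structure lemma for the crux `SubgroupIdentityDesigns`, stmt-MatrixMultiplication-14079;
cell B2b-5 `b2b-lgcu-borel`, gen 11 — report `run/shared/lean/b2b/levelgraded-cu/ORACLE-g11.md` §G11-4;
this is the soundness of "stage I" of the census engine `census_gen.c`)

Let `(H₁, H₂, H₃)` be a subgroup-TPP triple of `GL_m(𝔽_p)` and `f ∈ F_k|_G = levelSubmodule p m k` a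
level-`k` identity test on the triple products (`f 1 = 1`, `f (a b c) = 0` whenever `a b c ≠ 1`).
Averaging `f` over left translation by `H₁` and right translation by `H₃` stays in `F_k|_G`
(`levelSubmodule_bi_inv`) and produces an `(H₁, H₃)`-BI-INVARIANT level-`k` function `F` with
`F = 1` on the identity double coset `H₁ · 1 · H₃` and `F = 0` on every other double coset
`H₁ b H₃ ⊆ H₁H₂H₃` (`b ∈ H₂`, `b ≠ 1`) — `exists_biInvariant_separator`.  The TPP is used twice: the
only pair `(a, c) ∈ H₁ × H₃` with `a c = 1` is `(1, 1)`, and `a b c ≠ 1` when `b ≠ 1`.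
Contrapositive (`no_design_of_no_separator`): if the bi-invariant part of `F_k|_G` cannot separate the
identity double coset from the others inside `H₁H₂H₃` — a linear-algebra question on the (small) set of
double cosets, which is what the engine's stage I decides — then the identity-design clause of the crux
FAILS for `(H₁, H₂, H₃)` at level `k`.  (A bi-invariant annihilating weight is in particular a frame ghost,
`Negative/FrameGhost.lean`, so FAIL certificates from the sieve are checked by `no_design_of_frameGhost`.)
Sorry-free.  VALUE = necessary condition behind the (3,1,3) census verdicts, NOT summit progress; the crux
item stays open.
-/

set_option linter.dupNamespace false

noncomputable section

open scoped BigOperators Classical Matrix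

namespace Summit.MatrixMultiplication.MatrixMultiplication.Theorems.SubgroupIdentityDesigns.Negative
namespace DoubleCosetSieve

open Summit.MatrixMultiplication.MatrixMultiplication.Theorems.LieRankDesigns.Negative (GLm Mat fourierFn)
open Summit.MatrixMultiplication.MatrixMultiplication.Theorems.LevelOneGL2Designs.Negative
  (levelSubmodule levelSubmodule_bi_inv fourierFn_mem_levelSubmodule)
open Literature.Barriers.MatrixMultiplication (SubgroupTPP)

variable {p m k : ℕ} [hp : Fact p.Prime]

/-! Throughout, the `(H₁, H₃)`-BI-AVERAGE of `f` is the function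
`fun x => ∑ a : H₁, ∑ c : H₃, f ((a : GLm p m) * x * c)` (unnormalised; written out in every statement so
that the file introduces no definitions). -/

/-- The bi-average of a level-`k` function is a level-`k` function (`F_k|_G` is bi-invariant). -/
theorem biAvg_mem (H₁ H₃ : Subgroup (GLm p m)) {f : GLm p m → ℂ}
    (hf : f ∈ levelSubmodule p m k) :
    (fun x => ∑ a : H₁, ∑ c : H₃, f ((a : GLm p m) * x * c)) ∈ levelSubmodule p m k := by
  have hfun : (fun x => ∑ a : H₁, ∑ c : H₃, f ((a : GLm p m) * x * c)) =
      ∑ a : H₁, ∑ c : H₃, (fun x : GLm p m => f ((a : GLm p m) * x * c)) := by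
    ext x; simp [Finset.sum_apply]
  rw [hfun]
  exact Submodule.sum_mem _ fun a _ => Submodule.sum_mem _ fun c _ => levelSubmodule_bi_inv f hf _ _

/-- Left `H₁`-invariance of the bi-average (reindex `a ↦ a a₀`). -/
theorem biAvg_mul_left (H₁ H₃ : Subgroup (GLm p m)) (f : GLm p m → ℂ) {a₀ : GLm p m}
    (ha₀ : a₀ ∈ H₁) (x : GLm p m) :
    (∑ a : H₁, ∑ c : H₃, f ((a : GLm p m) * (a₀ * x) * c)) =
      ∑ a : H₁, ∑ c : H₃, f ((a : GLm p m) * x * c) := by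
  let e : H₁ ≃ H₁ := (Equiv.mulRight (⟨a₀, ha₀⟩ : H₁))
  refine (Fintype.sum_equiv e _ _ fun a => ?_)
  simp [e, mul_assoc]

/-- Right `H₃`-invariance of the bi-average (reindex `c ↦ c₀ c`). -/
theorem biAvg_mul_right (H₁ H₃ : Subgroup (GLm p m)) (f : GLm p m → ℂ) {c₀ : GLm p m}
    (hc₀ : c₀ ∈ H₃) (x : GLm p m) :
    (∑ a : H₁, ∑ c : H₃, f ((a : GLm p m) * (x * c₀) * c)) =
      ∑ a : H₁, ∑ c : H₃, f ((a : GLm p m) * x * c) := by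
  refine Finset.sum_congr rfl fun a _ => ?_
  let e : H₃ ≃ H₃ := (Equiv.mulLeft (⟨c₀, hc₀⟩ : H₃))
  refine (Fintype.sum_equiv e _ _ fun c => ?_)
  simp [e, mul_assoc]

variable {H₁ H₂ H₃ : Subgroup (GLm p m)}

/-- Under the TPP, the bi-average of an identity test takes the value `f 1 = 1` at the identity:
the only pair `(a, c) ∈ H₁ × H₃` with `a · 1 · c = 1` is `(1, 1)`. -/
theorem biAvg_one (htpp : SubgroupTPP H₁ H₂ H₃) {f : GLm p m → ℂ} (hf1 : f 1 = 1)
    (hf0 : ∀ a ∈ H₁, ∀ b ∈ H₂, ∀ c ∈ H₃, a * b * c ≠ 1 → f (a * b * c) = 0) :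
    (∑ a : H₁, ∑ c : H₃, f ((a : GLm p m) * 1 * c)) = 1 := by
  rw [Finset.sum_eq_single (⟨1, H₁.one_mem⟩ : H₁)]
  · rw [Finset.sum_eq_single (⟨1, H₃.one_mem⟩ : H₃)]
    · simpa using hf1
    · intro c _ hc
      have hne : (1 : GLm p m) * 1 * (c : GLm p m) ≠ 1 := by
        intro h
        have := (htpp 1 H₁.one_mem 1 H₂.one_mem c c.2 h).2.2
        exact hc (Subtype.ext this)
      simpa [mul_one] using hf0 1 H₁.one_mem 1 H₂.one_mem c c.2 hne
    · simp
  · intro a _ ha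
    refine Finset.sum_eq_zero fun c _ => ?_
    have hne : (a : GLm p m) * 1 * (c : GLm p m) ≠ 1 := by
      intro h
      have := (htpp a a.2 1 H₂.one_mem c c.2 h).1
      exact ha (Subtype.ext this)
    exact hf0 a a.2 1 H₂.one_mem c c.2 hne
  · simp

/-- Under the TPP, the bi-average of an identity test vanishes on every triple product with a
non-trivial middle factor. -/
theorem biAvg_eq_zero (htpp : SubgroupTPP H₁ H₂ H₃) {f : GLm p m → ℂ}
    (hf0 : ∀ a ∈ H₁, ∀ b ∈ H₂, ∀ c ∈ H₃, a * b * c ≠ 1 → f (a * b * c) = 0)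
    {a₀ b c₀ : GLm p m} (ha₀ : a₀ ∈ H₁) (hb : b ∈ H₂) (hc₀ : c₀ ∈ H₃) (hb1 : b ≠ 1) :
    (∑ a : H₁, ∑ c : H₃, f ((a : GLm p m) * (a₀ * b * c₀) * c)) = 0 := by
  refine Finset.sum_eq_zero fun a _ => Finset.sum_eq_zero fun c _ => ?_
  have hmem₁ : (a : GLm p m) * a₀ ∈ H₁ := H₁.mul_mem a.2 ha₀
  have hmem₃ : c₀ * (c : GLm p m) ∈ H₃ := H₃.mul_mem hc₀ c.2
  have hne : (a : GLm p m) * a₀ * b * (c₀ * c) ≠ 1 := fun h =>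
    hb1 (htpp _ hmem₁ b hb _ hmem₃ h).2.1
  have h0 := hf0 _ hmem₁ b hb _ hmem₃ hne
  have hassoc : (a : GLm p m) * (a₀ * b * c₀) * c = (a : GLm p m) * a₀ * b * (c₀ * c) := by
    simp [mul_assoc]
  rw [hassoc]; exact h0

/-- **THE DOUBLE-COSET SIEVE (necessary condition).**  If a subgroup-TPP triple `(H₁, H₂, H₃)` of
`GL_m(𝔽_p)` carries a level-`k` identity test `f` (`f ∈ F_k|_G`, `f 1 = 1`, `f` vanishes on the
non-identity triple products), then `F_k|_G` contains an `(H₁, H₃)`-bi-invariant function equal to `1`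
on the identity double coset `H₁H₃` and to `0` on every triple product `a b c` with `b ≠ 1`. -/
theorem exists_biInvariant_separator (htpp : SubgroupTPP H₁ H₂ H₃)
    (hdes : ∃ f ∈ levelSubmodule p m k, f 1 = 1 ∧
      ∀ a ∈ H₁, ∀ b ∈ H₂, ∀ c ∈ H₃, a * b * c ≠ 1 → f (a * b * c) = 0) :
    ∃ F ∈ levelSubmodule p m k,
      (∀ a ∈ H₁, ∀ x, F (a * x) = F x) ∧ (∀ c ∈ H₃, ∀ x, F (x * c) = F x) ∧
      (∀ a ∈ H₁, ∀ c ∈ H₃, F (a * c) = 1) ∧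
      (∀ a ∈ H₁, ∀ b ∈ H₂, ∀ c ∈ H₃, b ≠ 1 → F (a * b * c) = 0) := by
  obtain ⟨f, hf, hf1, hf0⟩ := hdes
  refine ⟨fun x => ∑ a : H₁, ∑ c : H₃, f ((a : GLm p m) * x * c), biAvg_mem H₁ H₃ hf,
    fun a ha x => biAvg_mul_left H₁ H₃ f ha x, fun c hc x => biAvg_mul_right H₁ H₃ f hc x,
    fun a ha c hc => ?_, fun a ha b hb c hc hb1 => biAvg_eq_zero htpp hf0 ha hb hc hb1⟩
  show (∑ a' : H₁, ∑ c' : H₃, f ((a' : GLm p m) * (a * c) * c')) = 1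
  rw [biAvg_mul_left H₁ H₃ f ha, show c = 1 * c from (one_mul c).symm,
    biAvg_mul_right H₁ H₃ f hc, biAvg_one htpp hf1 hf0]

/-- The same in the crux's own vocabulary (`c` supported on `rk M ≤ k`, `f = fourierFn c`): the
identity-design clause of `SubgroupIdentityDesigns` for `(H₁, H₂, H₃)` at level `k` forces a bi-invariant
level-`k` separator of the identity double coset. -/
theorem exists_biInvariant_separator_of_design (htpp : SubgroupTPP H₁ H₂ H₃)
    (hdes : ∃ c : Mat p m → ℂ, (∀ M, k < M.rank → c M = 0) ∧
      (∑ M, c M * ZMod.stdAddChar (Matrix.trace (M * ((1 : GLm p m) : Mat p m)))) = 1 ∧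
      ∀ a ∈ H₁, ∀ b ∈ H₂, ∀ g ∈ H₃, a * b * g ≠ 1 →
        (∑ M, c M * ZMod.stdAddChar (Matrix.trace (M * ((a * b * g : GLm p m) : Mat p m)))) = 0) :
    ∃ F ∈ levelSubmodule p m k,
      (∀ a ∈ H₁, ∀ x, F (a * x) = F x) ∧ (∀ c ∈ H₃, ∀ x, F (x * c) = F x) ∧
      (∀ a ∈ H₁, ∀ c ∈ H₃, F (a * c) = 1) ∧
      (∀ a ∈ H₁, ∀ b ∈ H₂, ∀ c ∈ H₃, b ≠ 1 → F (a * b * c) = 0) := by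
  obtain ⟨c, hc, hc1, hc0⟩ := hdes
  exact exists_biInvariant_separator htpp
    ⟨fourierFn c, fourierFn_mem_levelSubmodule hc, hc1, fun a ha b hb g hg hne => hc0 a ha b hb g hg hne⟩

/-- **Contrapositive (the sieve as a FAIL criterion).**  If no `(H₁, H₃)`-bi-invariant level-`k` function
separates the identity double coset `H₁H₃` from the triple products with non-trivial middle factor, the
identity-design clause of the crux fails for `(H₁, H₂, H₃)` at level `k`. -/
theorem no_design_of_no_separator (htpp : SubgroupTPP H₁ H₂ H₃)
    (hno : ¬ ∃ F ∈ levelSubmodule p m k,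
      (∀ a ∈ H₁, ∀ x, F (a * x) = F x) ∧ (∀ c ∈ H₃, ∀ x, F (x * c) = F x) ∧
      (∀ a ∈ H₁, ∀ c ∈ H₃, F (a * c) = 1) ∧
      (∀ a ∈ H₁, ∀ b ∈ H₂, ∀ c ∈ H₃, b ≠ 1 → F (a * b * c) = 0)) :
    ¬ ∃ c : Mat p m → ℂ, (∀ M, k < M.rank → c M = 0) ∧
      (∑ M, c M * ZMod.stdAddChar (Matrix.trace (M * ((1 : GLm p m) : Mat p m)))) = 1 ∧
      ∀ a ∈ H₁, ∀ b ∈ H₂, ∀ g ∈ H₃, a * b * g ≠ 1 →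
        (∑ M, c M * ZMod.stdAddChar (Matrix.trace (M * ((a * b * g : GLm p m) : Mat p m)))) = 0 :=
  fun hdes => hno (exists_biInvariant_separator_of_design htpp hdes)

end DoubleCosetSieve
end Summit.MatrixMultiplication.MatrixMultiplication.Theorems.SubgroupIdentityDesigns.Negative

end
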